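/-
Copyright: cell `pub-balaban-gaps` (G2), seat ne6 (row NE7b), `prover-pub-balaban-gaps-ne6-g14-0`; arithmetic companion of this seat's
`CompactFibreCreationFloorSU2` (V25) ∕ `CompactFibreWindowSU2Rate` (V26). Project licence.
-/
import Mathlib.Analysis.SpecialFunctions.Pow.Real

/-!
# THE CREATION-STEP LEDGER IN PRINT'S POWER-COUNTING REGIME: with letters growing as powers of `ℓ = log g_k⁻²`,
# `ℓ^{p₀} + i₀ + C_n ℓ^{a}·((3∕2)ℓ + c) ≤ c_S·ℓ^{s}` as soon as `p₀ + ε ≤ s`, `a + 1 + ε ≤ s` and `K ≤ c_S ℓ^{ε}` (row NE7b, node U5c; MODEL, [folklore])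

Cell `pub-balaban-gaps` (G2 spine census, V28) for the `pub-balaban` T⁴ crux NE7b (`T4WeightBudget.RelWeightBound`; the cell's OWN estimate — NOT PRINTED
in [Bałaban 1983–89], NOT PROVED).  MATHLIB ONLY (independent of every `BalabanUV` olean); no `def`; zero `sorry`.

WHY.  V25 (`CompactFibreCreationFloorSU2.creationPrice_SU2_factor_le_exp_neg`) reduced the (n)-carrier's creation step, in the `SU(2)` MODEL, to ONE ledger
inequality `P + i₀ + n·(letter) ≤ (λ∕2)δ′²`, and its §3 (`eventually_ledger_row`) certified the «`g_k` small» SHAPE of that row only at FIXED `n`, with the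
caveat (V25 docstring): «print's regime is NOT fixed-`n`: `n = #𝔹₀` and `W = 6(d+3)(100M(L+1)N^{β₀}R_j)^{d+2}` themselves grow like powers of `ℓ`
(`R_k = ℓ^{r₀}`), and it is print's exponent condition «`2p₁ − (d + 5)r₀ > p₀`» ([Balaban1989LargeFieldII] p. 383) that keeps the floor ahead of the
volume letter — NOT modelled here.»  THIS FILE models it.  Print's letters (p. 383, after (1.78)): the small factor to be sold is `exp(−p₀(g_j))`,
`p₀(g) = ℓ^{p₀}`; the floor is `½γ₀W⁻¹A₁²p₁²(g_j)`, which print bounds below by `R_j^{−(d+5)}p₁²(g_j) = ℓ^{2p₁ − (d+5)r₀}` («`exp(−½γ₀[6(d + 3)(100M(L + 1)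
N^{β₀}R_j)^{d+2}]^{−1}A₁²p₁(g_j)) < exp(−R_j^{−d−5}p₁²(g_j))`», three powers of `R_j` absorbing the constants) and then by `ℓ^{p₀}` («We assume that
`2p₁ − (d + 5)r₀ > p₀`, and we estimate the factors by `exp(−p₀(g_j))`»).  The MODEL ledger has two more debits than print's sentence: the window excess `i₀`
(bounded, V21) and the window-volume letter `n·((3∕2)·log η⁻¹ + c)` (V26, rate `3∕2 = ½d(𝔤)`; `log η⁻¹ ≤ ℓ` at a window radius `≥ g_k`), with the bond count
`n ≤ C_n ℓ^{a}` growing as a power of `ℓ` when the region is measured in `R_j`-units.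

WHAT.  §1 (monotonicity in the exponent is Mathlib's `Real.rpow_le_rpow_of_exponent_le`) **`ledger_row_of_exponents`**: for `ℓ ≥ 1`, `ε > 0`, exponents `p₀ + ε ≤ s`, `a + 1 + ε ≤ s` (`a ≥ 0`), constants `I₀, C_n, c ≥ 0`, `c_S > 0`, and
the ONE largeness row `K ≤ c_S·ℓ^{ε}` with `K := 1 + I₀ + C_n·(3∕2 + c)` (`ε > 0`):  `ℓ^{p₀} + I₀ + C_n·ℓ^{a}·((3∕2)·ℓ + c) ≤ c_S·ℓ^{s}`.  `largeness_row_of_le`: the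
row holds for every `ℓ ≥ (K∕c_S)^{1∕ε}` (so it is a «`g_k` small» row, `k`-uniform).  §2 print's exponent bookkeeping (`d = 4`): **`margins_of_print_condition`** —
print's «`2p₁ − 9r₀ > p₀`» together with the two mild rows `r₀ ≥ 0`, `p₀ ≥ 2r₀ + 1` gives the §1 margins with `ε = r₀` for the floor exponent `s = 2p₁ − 6r₀`
(the `W`-exponent `(d+2)r₀ = 6r₀`) and the bond-count exponent `a = 4r₀` (a box of side `∝ R_j` in `d = 4`); **`creation_ledger_print_regime`** = §1 ∘ §2:
under those rows and `K ≤ c_S ℓ^{r₀}`, `ℓ^{p₀} + I₀ + C_n ℓ^{4r₀}((3∕2)ℓ + c) ≤ c_S ℓ^{2p₁ − 6r₀}`.  §3 sanity.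

HONEST REMARKS.  Arithmetic only; MODEL bookkeeping.  Which exponents print fixes (`p₀`, `p₁`, `r₀`; the calc lane's values are «not of record» per the NE7b
refuter v112 F590), that the bond count of the (1.78) region is `∝ R_j^{d}` (here `a = 4r₀`; the letters `M`, `L`, `N^{β₀}` held constant), and the identification
of `c_S`, `C_n`, `I₀`, `c` with print's `½γ₀A₁²∕(6(d+3)(100M(L+1)N^{β₀})^{d+2})`, `d(100M(L+1)N^{β₀})^{d}`, V21's excess and V26's `log 160` are (A3) readings,
NOT asserted (`N` is the number of recent one-step operations written out in [Balaban1989LargeFieldI] p. 178 (1.2), «`h = k − N`», so `N^{β₀}` is not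
literally `k`-independent — print absorbs it, with the other constants, into three powers of `R_j`; here it sits inside `c_S`, `C_n`); print itself pays the volume letter elsewhere ((1.10)'s `E_k(Λ)` is a vacuum-energy counterterm), so this row is the MODEL's, stricter than
print's sentence.  BY-NAME EFFECT ON THE WALL: NONE.  NE7b NOT PRINTED ∕ NOT PROVED; spine PROVED 0∕9; rung (B)+1 on ONE finite T⁴ — NOT infinite volume,
NOT the mass gap, NOT Clay.
v2 (seat ne6 gen 15, APPEND-ONLY; v1.2 declarations byte-identical).  §4 ANY RATE: the same ledger with the volume letter at an ARBITRARY rate `r ≥ 0` per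
bond in place of `3∕2` — `ledger_row_of_exponents_rate`, `creation_ledger_print_regime_rate(_of_le)` — and the `SU(N)` instance `r = (N² − 1)∕2 = ½·dim SU(N)`
(`creation_ledger_print_regime_SUN`), the rate delivered for every `N` by this seat's `CompactFibreWindowSUNRate` (census V29): print's exponent condition
«`2p₁ − 9r₀ > p₀`» does not see the rank of the group — the rate enters ONLY the largeness row `1 + I₀ + C_n·(r + c) ≤ c_S·ℓ^{r₀}`, i.e. one threshold
`ℓ ≥ ((1 + I₀ + C_n(r + c))∕c_S)^{1∕r₀}`.  MODEL arithmetic, Mathlib only; nothing of Bałaban's asserted.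
HONEST DEPENDENCY: continuum YM on T⁴ ⇐ BetaPertH ∧ nine spine estimates (0/9 proved); BetaPertH ⇐ (D1) ∧ (D4) ∧ CAP+tail;
G-an2-4 gates asym, D1 and NE2/3/4.  This file changes none of it.
-/

set_option autoImplicit false

noncomputable section

open Real

namespace Summit.QuantumFields.BalabanUV.T4Continuum.NE7b.CreationLedgerPowerCounting

/-! ## §1 The ledger row with letters growing as powers of `ℓ` -/

/-- **THE LEDGER ROW WITH GROWING LETTERS.**  For `ℓ ≥ 1`, exponents with margins `p₀ + ε ≤ s` and `a + 1 + ε ≤ s` (`a ≥ 0`; `ε > 0` in every use),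
constants `I₀, C_n, c ≥ 0`, and the largeness row `1 + I₀ + C_n·(3∕2 + c) ≤ c_S·ℓ^{ε}`:
`ℓ^{p₀} + I₀ + C_n·ℓ^{a}·((3∕2)·ℓ + c) ≤ c_S·ℓ^{s}`. [folklore] -/
theorem ledger_row_of_exponents {ℓ ε p₀ a s I₀ Cn c cS : ℝ} (hℓ : 1 ≤ ℓ) (ha : 0 ≤ a) (hp : p₀ + ε ≤ s) (has : a + 1 + ε ≤ s)
    (hI : 0 ≤ I₀) (hCn : 0 ≤ Cn) (hc : 0 ≤ c) (hK : 1 + I₀ + Cn * (3 / 2 + c) ≤ cS * ℓ ^ ε) :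
    ℓ ^ p₀ + I₀ + Cn * ℓ ^ a * (3 / 2 * ℓ + c) ≤ cS * ℓ ^ s := by
  have hℓ0 : 0 < ℓ := by linarith
  have hse : 0 ≤ s - ε := by linarith
  -- every debit is at most its constant times `ℓ^{s − ε}`
  have h1 : ℓ ^ p₀ ≤ ℓ ^ (s - ε) := Real.rpow_le_rpow_of_exponent_le hℓ (by linarith)
  have h2 : I₀ ≤ I₀ * ℓ ^ (s - ε) := by
    have : (1 : ℝ) ≤ ℓ ^ (s - ε) := Real.one_le_rpow hℓ hse
    nlinarith
  have h3 : ℓ ^ a * (3 / 2 * ℓ + c) ≤ (3 / 2 + c) * ℓ ^ (s - ε) := by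
    have ha1 : ℓ ^ a * ℓ = ℓ ^ (a + 1) := by rw [Real.rpow_add hℓ0, Real.rpow_one]
    have hmono : ℓ ^ (a + 1) ≤ ℓ ^ (s - ε) := Real.rpow_le_rpow_of_exponent_le hℓ (by linarith)
    have hℓa : 0 ≤ ℓ ^ a := (Real.rpow_pos_of_pos hℓ0 a).le
    have hca : ℓ ^ a * c ≤ c * ℓ ^ (s - ε) := by
      have : ℓ ^ a ≤ ℓ ^ (s - ε) := Real.rpow_le_rpow_of_exponent_le hℓ (by linarith)
      nlinarith
    calc ℓ ^ a * (3 / 2 * ℓ + c) = 3 / 2 * (ℓ ^ a * ℓ) + ℓ ^ a * c := by ring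
      _ ≤ 3 / 2 * ℓ ^ (s - ε) + c * ℓ ^ (s - ε) := by rw [ha1]; exact add_le_add (by nlinarith) hca
      _ = (3 / 2 + c) * ℓ ^ (s - ε) := by ring
  have h3' : Cn * ℓ ^ a * (3 / 2 * ℓ + c) ≤ Cn * ((3 / 2 + c) * ℓ ^ (s - ε)) := by
    rw [mul_assoc]; exact mul_le_mul_of_nonneg_left h3 hCn
  -- and the largeness row turns `K·ℓ^{s−ε}` into `c_S·ℓ^{s}`
  have hsplit : cS * ℓ ^ s = (cS * ℓ ^ ε) * ℓ ^ (s - ε) := by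
    rw [mul_assoc, ← Real.rpow_add hℓ0]; ring_nf
  have hpos : 0 ≤ ℓ ^ (s - ε) := (Real.rpow_pos_of_pos hℓ0 _).le
  calc ℓ ^ p₀ + I₀ + Cn * ℓ ^ a * (3 / 2 * ℓ + c)
      ≤ ℓ ^ (s - ε) + I₀ * ℓ ^ (s - ε) + Cn * ((3 / 2 + c) * ℓ ^ (s - ε)) := add_le_add (add_le_add h1 h2) h3'
    _ = (1 + I₀ + Cn * (3 / 2 + c)) * ℓ ^ (s - ε) := by ring
    _ ≤ (cS * ℓ ^ ε) * ℓ ^ (s - ε) := mul_le_mul_of_nonneg_right hK hpos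
    _ = cS * ℓ ^ s := hsplit.symm

/-- **THE LARGENESS ROW IS A «`g_k` SMALL» ROW**: `K ≤ c_S·ℓ^{ε}` holds for every `ℓ ≥ (K∕c_S)^{1∕ε}` (`K ≥ 0`, `c_S, ε > 0`). [folklore] -/
theorem largeness_row_of_le {ℓ ε K cS : ℝ} (hε : 0 < ε) (hK : 0 ≤ K) (hcS : 0 < cS) (hℓ : (K / cS) ^ (1 / ε) ≤ ℓ) : K ≤ cS * ℓ ^ ε := by
  have h0 : 0 ≤ K / cS := div_nonneg hK hcS.le
  have h1 : K / cS ≤ ℓ ^ ε := by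
    have h := Real.rpow_le_rpow (Real.rpow_nonneg h0 _) hℓ hε.le
    rwa [← Real.rpow_mul h0, one_div_mul_cancel hε.ne', Real.rpow_one] at h
  rwa [div_le_iff₀ hcS, mul_comm] at h1

/-! ## §2 Print's exponent condition (d = 4): «`2p₁ − (d + 5)r₀ > p₀`» supplies the margins -/

/-- **PRINT'S CONDITION GIVES THE MARGINS** (`d = 4`): from «`2p₁ − 9r₀ > p₀`» ([Balaban1989LargeFieldII] p. 383) and the two mild rows `0 ≤ r₀`,
`2r₀ + 1 ≤ p₀`, the §1 margins hold with `ε = r₀` for the floor exponent `s = 2p₁ − 6r₀` and the bond-count exponent `a = 4r₀`: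
`p₀ + r₀ ≤ 2p₁ − 6r₀` and `4r₀ + 1 + r₀ ≤ 2p₁ − 6r₀`. [folklore] -/
theorem margins_of_print_condition {p₀ p₁ r₀ : ℝ} (hprint : p₀ < 2 * p₁ - 9 * r₀) (hr : 0 ≤ r₀) (hp0 : 2 * r₀ + 1 ≤ p₀) :
    p₀ + r₀ ≤ 2 * p₁ - 6 * r₀ ∧ 4 * r₀ + 1 + r₀ ≤ 2 * p₁ - 6 * r₀ := by
  constructor <;> linarith

/-- **THE CREATION LEDGER IN PRINT'S REGIME** (`d = 4`, MODEL): with `ℓ ≥ 1`, print's «`2p₁ − 9r₀ > p₀`», the mild rows `0 ≤ r₀`, `2r₀ + 1 ≤ p₀`, constants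
`I₀, C_n, c ≥ 0`, and the largeness row `1 + I₀ + C_n·(3∕2 + c) ≤ c_S·ℓ^{r₀}`:
`ℓ^{p₀} + I₀ + C_n·ℓ^{4r₀}·((3∕2)·ℓ + c) ≤ c_S·ℓ^{2p₁ − 6r₀}` — the small factor `e^{−ℓ^{p₀}}`, the window excess and the rate-`3∕2` volume letter of a region of
`∝ R_j⁴ = ℓ^{4r₀}` bonds are all paid by the floor `c_S·ℓ^{2p₁}∕ℓ^{6r₀}`. [folklore] -/
theorem creation_ledger_print_regime {ℓ p₀ p₁ r₀ I₀ Cn c cS : ℝ} (hℓ : 1 ≤ ℓ) (hprint : p₀ < 2 * p₁ - 9 * r₀) (hr : 0 ≤ r₀) (hp0 : 2 * r₀ + 1 ≤ p₀)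
    (hI : 0 ≤ I₀) (hCn : 0 ≤ Cn) (hc : 0 ≤ c) (hK : 1 + I₀ + Cn * (3 / 2 + c) ≤ cS * ℓ ^ r₀) :
    ℓ ^ p₀ + I₀ + Cn * ℓ ^ (4 * r₀) * (3 / 2 * ℓ + c) ≤ cS * ℓ ^ (2 * p₁ - 6 * r₀) := by
  obtain ⟨hp, ha⟩ := margins_of_print_condition hprint hr hp0
  exact ledger_row_of_exponents hℓ (by linarith) hp ha hI hCn hc hK

/-- The same with the largeness row discharged by an explicit threshold: `ℓ ≥ max(1, (K∕c_S)^{1∕r₀})` (`r₀, c_S > 0`). [folklore] -/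
theorem creation_ledger_print_regime_of_le {ℓ p₀ p₁ r₀ I₀ Cn c cS : ℝ} (hprint : p₀ < 2 * p₁ - 9 * r₀) (hr : 0 < r₀) (hp0 : 2 * r₀ + 1 ≤ p₀)
    (hI : 0 ≤ I₀) (hCn : 0 ≤ Cn) (hc : 0 ≤ c) (hcS : 0 < cS) (hℓ1 : 1 ≤ ℓ)
    (hℓ : ((1 + I₀ + Cn * (3 / 2 + c)) / cS) ^ (1 / r₀) ≤ ℓ) :
    ℓ ^ p₀ + I₀ + Cn * ℓ ^ (4 * r₀) * (3 / 2 * ℓ + c) ≤ cS * ℓ ^ (2 * p₁ - 6 * r₀) :=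
  creation_ledger_print_regime hℓ1 hprint hr.le hp0 hI hCn hc (largeness_row_of_le hr (by positivity) hcS hℓ)

/-! ## §3 Sanity -/

/-- Toy for §2's margins at sample exponents `(p₀, p₁, r₀) = (4, 12, 1)`: `2·12 − 9 > 4`, `2·1 + 1 ≤ 4`. -/
example : (4 : ℝ) + 1 ≤ 2 * 12 - 6 * 1 ∧ 4 * (1 : ℝ) + 1 + 1 ≤ 2 * 12 - 6 * 1 :=
  margins_of_print_condition (by norm_num) zero_le_one (by norm_num)

/-- Toy for §1 with no volume debit (`C_n = 0`), `I₀ = 0`, `ε = 1`, `ℓ = 2`, `c_S = 1`: `2^{1} + 0 + 0 ≤ 2^{2}`. -/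
example : (2 : ℝ) ^ (1 : ℝ) + 0 + 0 * (2 : ℝ) ^ (0 : ℝ) * (3 / 2 * 2 + 0) ≤ 1 * (2 : ℝ) ^ (2 : ℝ) :=
  ledger_row_of_exponents (ε := 1) (by norm_num) le_rfl (by norm_num) (by norm_num) le_rfl le_rfl le_rfl (by rw [Real.rpow_one]; norm_num)

/-! ## §4 (v2) Any rate `r ≥ 0` per bond — the `SU(N)` letter `r = (N² − 1)∕2` of `CompactFibreWindowSUNRate` -/

/-- **THE LEDGER ROW AT AN ARBITRARY RATE.**  For `ℓ ≥ 1`, margins `p₀ + ε ≤ s`, `a + 1 + ε ≤ s` (`a ≥ 0`), constants `I₀, C_n, c, r ≥ 0` and the largeness row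
`1 + I₀ + C_n·(r + c) ≤ c_S·ℓ^{ε}`: `ℓ^{p₀} + I₀ + C_n·ℓ^{a}·(r·ℓ + c) ≤ c_S·ℓ^{s}` (§1 is the instance `r = 3∕2`). [folklore] -/
theorem ledger_row_of_exponents_rate {ℓ ε p₀ a s I₀ Cn c cS r : ℝ} (hℓ : 1 ≤ ℓ) (ha : 0 ≤ a) (hp : p₀ + ε ≤ s) (has : a + 1 + ε ≤ s)
    (hI : 0 ≤ I₀) (hCn : 0 ≤ Cn) (hc : 0 ≤ c) (hr : 0 ≤ r) (hK : 1 + I₀ + Cn * (r + c) ≤ cS * ℓ ^ ε) :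
    ℓ ^ p₀ + I₀ + Cn * ℓ ^ a * (r * ℓ + c) ≤ cS * ℓ ^ s := by
  have hℓ0 : 0 < ℓ := by linarith
  have hse : 0 ≤ s - ε := by linarith
  have h1 : ℓ ^ p₀ ≤ ℓ ^ (s - ε) := Real.rpow_le_rpow_of_exponent_le hℓ (by linarith)
  have h2 : I₀ ≤ I₀ * ℓ ^ (s - ε) := by
    have : (1 : ℝ) ≤ ℓ ^ (s - ε) := Real.one_le_rpow hℓ hse
    nlinarith
  have h3 : ℓ ^ a * (r * ℓ + c) ≤ (r + c) * ℓ ^ (s - ε) := by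
    have ha1 : ℓ ^ a * ℓ = ℓ ^ (a + 1) := by rw [Real.rpow_add hℓ0, Real.rpow_one]
    have hmono : ℓ ^ (a + 1) ≤ ℓ ^ (s - ε) := Real.rpow_le_rpow_of_exponent_le hℓ (by linarith)
    have hℓa : 0 ≤ ℓ ^ a := (Real.rpow_pos_of_pos hℓ0 a).le
    have hmono' : ℓ ^ a ≤ ℓ ^ (s - ε) := Real.rpow_le_rpow_of_exponent_le hℓ (by linarith)
    calc ℓ ^ a * (r * ℓ + c) = r * (ℓ ^ a * ℓ) + c * ℓ ^ a := by ring
      _ ≤ r * ℓ ^ (s - ε) + c * ℓ ^ (s - ε) := by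
          rw [ha1]; exact add_le_add (mul_le_mul_of_nonneg_left hmono hr) (mul_le_mul_of_nonneg_left hmono' hc)
      _ = (r + c) * ℓ ^ (s - ε) := by ring
  have h3' : Cn * ℓ ^ a * (r * ℓ + c) ≤ Cn * ((r + c) * ℓ ^ (s - ε)) := by
    rw [mul_assoc]; exact mul_le_mul_of_nonneg_left h3 hCn
  have hsplit : cS * ℓ ^ s = (cS * ℓ ^ ε) * ℓ ^ (s - ε) := by
    rw [mul_assoc, ← Real.rpow_add hℓ0]; ring_nf
  have hpos : 0 ≤ ℓ ^ (s - ε) := (Real.rpow_pos_of_pos hℓ0 _).le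
  calc ℓ ^ p₀ + I₀ + Cn * ℓ ^ a * (r * ℓ + c)
      ≤ ℓ ^ (s - ε) + I₀ * ℓ ^ (s - ε) + Cn * ((r + c) * ℓ ^ (s - ε)) := add_le_add (add_le_add h1 h2) h3'
    _ = (1 + I₀ + Cn * (r + c)) * ℓ ^ (s - ε) := by ring
    _ ≤ (cS * ℓ ^ ε) * ℓ ^ (s - ε) := mul_le_mul_of_nonneg_right hK hpos
    _ = cS * ℓ ^ s := hsplit.symm

/-- **THE CREATION LEDGER IN PRINT'S REGIME AT ANY RATE** (`d = 4`, MODEL): print's «`2p₁ − 9r₀ > p₀`», the mild rows `0 ≤ r₀`, `2r₀ + 1 ≤ p₀`, constants `I₀, C_n, c, r ≥ 0`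
and the largeness row `1 + I₀ + C_n·(r + c) ≤ c_S·ℓ^{r₀}` give `ℓ^{p₀} + I₀ + C_n·ℓ^{4r₀}·(r·ℓ + c) ≤ c_S·ℓ^{2p₁ − 6r₀}` — the exponent condition does not see `r`. [folklore] -/
theorem creation_ledger_print_regime_rate {ℓ p₀ p₁ r₀ I₀ Cn c cS r : ℝ} (hℓ : 1 ≤ ℓ) (hprint : p₀ < 2 * p₁ - 9 * r₀) (hr₀ : 0 ≤ r₀) (hp0 : 2 * r₀ + 1 ≤ p₀)
    (hI : 0 ≤ I₀) (hCn : 0 ≤ Cn) (hc : 0 ≤ c) (hr : 0 ≤ r) (hK : 1 + I₀ + Cn * (r + c) ≤ cS * ℓ ^ r₀) :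
    ℓ ^ p₀ + I₀ + Cn * ℓ ^ (4 * r₀) * (r * ℓ + c) ≤ cS * ℓ ^ (2 * p₁ - 6 * r₀) := by
  obtain ⟨hp, ha⟩ := margins_of_print_condition hprint hr₀ hp0
  exact ledger_row_of_exponents_rate hℓ (by linarith) hp ha hI hCn hc hr hK

/-- The same with the largeness row discharged by the explicit threshold `ℓ ≥ max(1, ((1 + I₀ + C_n(r + c))∕c_S)^{1∕r₀})` (`r₀, c_S > 0`) — the ONLY place the rate enters. [folklore] -/
theorem creation_ledger_print_regime_rate_of_le {ℓ p₀ p₁ r₀ I₀ Cn c cS r : ℝ} (hprint : p₀ < 2 * p₁ - 9 * r₀) (hr₀ : 0 < r₀) (hp0 : 2 * r₀ + 1 ≤ p₀)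
    (hI : 0 ≤ I₀) (hCn : 0 ≤ Cn) (hc : 0 ≤ c) (hr : 0 ≤ r) (hcS : 0 < cS) (hℓ1 : 1 ≤ ℓ)
    (hℓ : ((1 + I₀ + Cn * (r + c)) / cS) ^ (1 / r₀) ≤ ℓ) :
    ℓ ^ p₀ + I₀ + Cn * ℓ ^ (4 * r₀) * (r * ℓ + c) ≤ cS * ℓ ^ (2 * p₁ - 6 * r₀) :=
  creation_ledger_print_regime_rate hℓ1 hprint hr₀.le hp0 hI hCn hc hr (largeness_row_of_le hr₀ (by positivity) hcS hℓ)

/-- **THE `SU(N)` INSTANCE**: the rate `r = (N² − 1)∕2 = ½·dim SU(N)` of `CompactFibreWindowSUNRate.exists_abs_neg_log_pi_traceWindow_sub_le` (per bond, `(N² − 1)∕2·log t⁻¹ + c`):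
for every `N`, print's regime closes the creation ledger `ℓ^{p₀} + I₀ + C_n·ℓ^{4r₀}·(((N² − 1)∕2)·ℓ + c) ≤ c_S·ℓ^{2p₁ − 6r₀}` once `ℓ ≥ max(1, ((1 + I₀ + C_n((N² − 1)∕2 + c))∕c_S)^{1∕r₀})`
(`N = 2`: §2's rate `3∕2`). [folklore] -/
theorem creation_ledger_print_regime_SUN (N : ℕ) {ℓ p₀ p₁ r₀ I₀ Cn c cS : ℝ} (hprint : p₀ < 2 * p₁ - 9 * r₀) (hr₀ : 0 < r₀) (hp0 : 2 * r₀ + 1 ≤ p₀)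
    (hI : 0 ≤ I₀) (hCn : 0 ≤ Cn) (hc : 0 ≤ c) (hcS : 0 < cS) (hℓ1 : 1 ≤ ℓ)
    (hℓ : ((1 + I₀ + Cn * (((N ^ 2 - 1 : ℕ) : ℝ) / 2 + c)) / cS) ^ (1 / r₀) ≤ ℓ) :
    ℓ ^ p₀ + I₀ + Cn * ℓ ^ (4 * r₀) * (((N ^ 2 - 1 : ℕ) : ℝ) / 2 * ℓ + c) ≤ cS * ℓ ^ (2 * p₁ - 6 * r₀) :=
  creation_ledger_print_regime_rate_of_le hprint hr₀ hp0 hI hCn hc (by positivity) hcS hℓ1 hℓ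

/-- §1 is the instance `r = 3∕2` of §4 (sanity: the two ledgers agree at `N = 2`, `(2² − 1)∕2 = 3∕2`). -/
example {ℓ ε p₀ a s I₀ Cn c cS : ℝ} (hℓ : 1 ≤ ℓ) (ha : 0 ≤ a) (hp : p₀ + ε ≤ s) (has : a + 1 + ε ≤ s) (hI : 0 ≤ I₀) (hCn : 0 ≤ Cn) (hc : 0 ≤ c)
    (hK : 1 + I₀ + Cn * (3 / 2 + c) ≤ cS * ℓ ^ ε) : ℓ ^ p₀ + I₀ + Cn * ℓ ^ a * (3 / 2 * ℓ + c) ≤ cS * ℓ ^ s :=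
  ledger_row_of_exponents_rate hℓ ha hp has hI hCn hc (by norm_num) hK

/-- `(2² − 1)∕2 = 3∕2`. -/
example : ((2 ^ 2 - 1 : ℕ) : ℝ) / 2 = 3 / 2 := by norm_num

end Summit.QuantumFields.BalabanUV.T4Continuum.NE7b.CreationLedgerPowerCounting

end
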